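import Mathlib
import Literature.Probability.Percolation.QuadCrossingSquareModel
import Literature.Topology.PlaneTopology.Brouwer

/-!
# Perturbed conformal rectangles in a square model — part 1: margins (stub `stub_perturbedRectangles`)

Crux `Summit.CriticalPhenomena.CardyFormulaZ2.Theses.CardyFlipRusso.SquareFromVoronoiHub`
(stmt-CriticalPhenomena-6434), line `Sketch`, stub `stub_perturbedRectangles` (S1: perturbed conformal
rectangles; pure plane topology, no probability).  Support file: the METRIC and CROSSING clauses of the
specifications `lowerMargins` / `upperMargins` (module `…FaithfulDefs`) for Schramm–Smirnov's perturbed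
quads read in a square model.

Everything is read through a homeomorphism `Ψ : ℂ ≃ₜ ℂ` of the plane (a square model of the conformal
rectangle, `exists_isSquareModel`, Schoenflies): the perturbed quad is `Ψ([-1+κ, 1-κ] × [-1-κ, 1+κ])`
(`perturbQuad`; caps beyond the bottom/top sides of the model square `[-1,1]²`, collars off the
left/right sides), the cap sets are `Ψ([-1+κ/2, 1-κ/2] × [-1-2κ, -1])`, `Ψ([-1+κ/2, 1-κ/2] × [1, 1+2κ])`.
Small `r`-neighbourhoods in the plane pull back into prescribed open model neighbourhoods
(`IsCompact.exists_cthickening_subset_open`), so all clauses become statements about axis-parallel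
boxes; the crossing clause becomes "a bottom–top crossing of a rectangle meets a left–right one"
(`exists_mem_of_crossing`, after clipping both paths with `exists_Icc_passage`).

`Perturbed.eventually_lower` collects the cap/collar clauses of `lowerMargins` for the perturbed quad of
a square model `Φ` of `R` (`IsSquareModel R Φ`), `Perturbed.eventually_crossing` is the crossing clause of
`upperMargins`.  All statements are `∀ᶠ r in 𝓝[>] 0`, so that finitely many of them can be combined;
the registered sub-goal `stub_perturbedRectangles_part1` is the crossing clause.
-/

noncomputable section

namespace Summit.CriticalPhenomena.CardyFormulaZ2.Cruxes.SquareFromVoronoiHub.VoronoiBlocks.Faithful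

open scoped Topology
open Set Filter Metric Complex
open Literature.Probability.Percolation (perturbQuad unitSquareQuad IsSquareModel exists_Icc_passage)
open Literature.Probability.RandomPlanarGeometry (ConformalRectangle)

namespace Perturbed

/-! ### Two metric lemmas: small neighbourhoods of a compact set -/

/-- A compact non-empty set inside an open set: for all small `r > 0`, every point within `r` of the
compact set lies in the open set (`IsCompact.exists_cthickening_subset_open`). [folklore] -/
theorem eventually_mem_of_infDist_le {K U : Set ℂ} (hK : IsCompact K) (hKne : K.Nonempty)
    (hU : IsOpen U) (hKU : K ⊆ U) :
    ∀ᶠ r in 𝓝[>] (0 : ℝ), ∀ z, infDist z K ≤ r → z ∈ U := by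
  obtain ⟨ρ, hρ, hsub⟩ := hK.exists_cthickening_subset_open hU hKU
  filter_upwards [Ioc_mem_nhdsGT hρ] with r hr z hz
  obtain ⟨p, hp, hpd⟩ := hK.exists_infDist_eq_dist hKne z
  refine hsub (cthickening_mono hr.2 K (mem_cthickening_of_dist_le z p r K hp ?_))
  rwa [← hpd]

/-- A compact non-empty set `K` and a disjoint closed non-empty set `L`: for all small `r > 0`, every
point within `r` of `K` is at distance `≥ r` from `L`. [folklore] -/
theorem eventually_le_infDist {K L : Set ℂ} (hK : IsCompact K) (hKne : K.Nonempty) (hL : IsClosed L)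
    (hLne : L.Nonempty) (hKL : Disjoint K L) :
    ∀ᶠ r in 𝓝[>] (0 : ℝ), ∀ z, infDist z K ≤ r → r ≤ infDist z L := by
  obtain ⟨ρ, hρ, hsub⟩ := hK.exists_cthickening_subset_open hL.isOpen_compl
    (subset_compl_iff_disjoint_right.2 hKL)
  have hρ2 : (0 : ℝ) < ρ / 2 := by positivity
  filter_upwards [Ioc_mem_nhdsGT hρ2] with r hr z hz
  by_contra hlt
  push Not at hlt
  obtain ⟨w, hw, hzw⟩ := (infDist_lt_iff hLne).1 hlt
  obtain ⟨p, hp, hpd⟩ := hK.exists_infDist_eq_dist hKne z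
  have hwp : dist w p ≤ ρ := by
    have := dist_triangle w z p
    rw [dist_comm w z, ← hpd] at this
    linarith [hr.2]
  exact hsub (mem_cthickening_of_dist_le w p ρ K hp hwp) hw

/-- Pull-back form through a homeomorphism `Ψ` of the plane: if `Ψ⁻¹` maps the compact non-empty set
`K` into the open model set `U`, then for all small `r > 0` so it does the `r`-neighbourhood of `K`. [folklore] -/
theorem eventually_symm_mem (Ψ : ℂ ≃ₜ ℂ) {K U : Set ℂ} (hK : IsCompact K) (hKne : K.Nonempty)
    (hU : IsOpen U) (hKU : ∀ z ∈ K, Ψ.symm z ∈ U) :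
    ∀ᶠ r in 𝓝[>] (0 : ℝ), ∀ z, infDist z K ≤ r → Ψ.symm z ∈ U :=
  eventually_mem_of_infDist_le hK hKne (hU.preimage Ψ.symm.continuous) fun z hz => hKU z hz

/-! ### The perturbed quad `Ψ([-1+κ, 1-κ] × [-1-κ, 1+κ])` read in the model -/

section Model

variable (Ψ : ℂ ≃ₜ ℂ) {κ : ℝ} (hx : -1 + κ < 1 - κ) (hy : -1 - κ < 1 + κ)

/-- The closed perturbed quad is compact. [folklore] -/
theorem isCompact_closure_perturbQuad :
    IsCompact (closure (perturbQuad Ψ (-1 + κ) (1 - κ) (-1 - κ) (1 + κ) hx hy).carrier) :=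
  (perturbQuad Ψ (-1 + κ) (1 - κ) (-1 - κ) (1 + κ) hx hy).isBounded.isCompact_closure

/-- The closed perturbed quad is non-empty. [folklore] -/
theorem closure_perturbQuad_nonempty :
    (closure (perturbQuad Ψ (-1 + κ) (1 - κ) (-1 - κ) (1 + κ) hx hy).carrier).Nonempty :=
  (perturbQuad Ψ (-1 + κ) (1 - κ) (-1 - κ) (1 + κ) hx hy).nonempty.closure

/-- Near the closed perturbed quad, the model ordinate stays inside `(-(1+2κ), 1+2κ)` and the model
abscissa inside `(-(1-κ/2), 1-κ/2)`. [folklore] -/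
theorem eventually_mem_box (hκ : 0 < κ) : ∀ᶠ r in 𝓝[>] (0 : ℝ), ∀ z,
    infDist z (closure (perturbQuad Ψ (-1 + κ) (1 - κ) (-1 - κ) (1 + κ) hx hy).carrier) ≤ r →
      |(Ψ.symm z).re| < 1 - κ / 2 ∧ |(Ψ.symm z).im| < 1 + 2 * κ := by
  refine eventually_symm_mem Ψ (U := {w | |w.re| < 1 - κ / 2 ∧ |w.im| < 1 + 2 * κ})
    (isCompact_closure_perturbQuad Ψ hx hy) (closure_perturbQuad_nonempty Ψ hx hy)
    ((isOpen_lt continuous_re.abs continuous_const).and (isOpen_lt continuous_im.abs continuous_const))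
    fun z hz => ?_
  obtain ⟨⟨h1, h2⟩, h3, h4⟩ := (Literature.Probability.Percolation.mem_closure_perturbQuad_carrier hx hy Ψ).1 hz
  show |(Ψ.symm z).re| < 1 - κ / 2 ∧ |(Ψ.symm z).im| < 1 + 2 * κ
  rw [abs_lt, abs_lt]; refine ⟨⟨?_, ?_⟩, ?_, ?_⟩ <;> linarith

/-- Near arc `0` of the perturbed quad (the bottom cap edge `[-1+κ, 1-κ] × {-1-κ}`), the model point lies
in the open box `(-(1-κ/2), 1-κ/2) × (-1-2κ, -1-κ/2)`. [folklore] -/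
theorem eventually_arc_zero (hκ : 0 < κ) : ∀ᶠ r in 𝓝[>] (0 : ℝ), ∀ z,
    infDist z ((perturbQuad Ψ (-1 + κ) (1 - κ) (-1 - κ) (1 + κ) hx hy).arc 0) ≤ r →
      |(Ψ.symm z).re| < 1 - κ / 2 ∧ -1 - 2 * κ < (Ψ.symm z).im ∧ (Ψ.symm z).im < -1 - κ / 2 := by
  set Q := perturbQuad Ψ (-1 + κ) (1 - κ) (-1 - κ) (1 + κ) hx hy with hQ
  refine eventually_symm_mem Ψ (U := {w | |w.re| < 1 - κ / 2 ∧ -1 - 2 * κ < w.im ∧ w.im < -1 - κ / 2})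
    (Q.isCompact_arc 0) ⟨_, Q.pt_mem_arc_self 0⟩
    ((isOpen_lt continuous_re.abs continuous_const).and ((isOpen_lt continuous_const continuous_im).and
      (isOpen_lt continuous_im continuous_const))) fun z hz => ?_
  obtain ⟨h1, h2, h3⟩ := (Literature.Probability.Percolation.mem_perturbQuad_arc_zero hx hy Ψ).1 hz
  show |(Ψ.symm z).re| < 1 - κ / 2 ∧ -1 - 2 * κ < (Ψ.symm z).im ∧ (Ψ.symm z).im < -1 - κ / 2
  rw [abs_lt, h1]; refine ⟨⟨?_, ?_⟩, ?_, ?_⟩ <;> linarith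

/-- Near arc `2` of the perturbed quad (the top cap edge `[-1+κ, 1-κ] × {1+κ}`), the model point lies in
the open box `(-(1-κ/2), 1-κ/2) × (1+κ/2, 1+2κ)`. [folklore] -/
theorem eventually_arc_two (hκ : 0 < κ) : ∀ᶠ r in 𝓝[>] (0 : ℝ), ∀ z,
    infDist z ((perturbQuad Ψ (-1 + κ) (1 - κ) (-1 - κ) (1 + κ) hx hy).arc 2) ≤ r →
      |(Ψ.symm z).re| < 1 - κ / 2 ∧ 1 + κ / 2 < (Ψ.symm z).im ∧ (Ψ.symm z).im < 1 + 2 * κ := by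
  set Q := perturbQuad Ψ (-1 + κ) (1 - κ) (-1 - κ) (1 + κ) hx hy with hQ
  refine eventually_symm_mem Ψ (U := {w | |w.re| < 1 - κ / 2 ∧ 1 + κ / 2 < w.im ∧ w.im < 1 + 2 * κ})
    (Q.isCompact_arc 2) ⟨_, Q.pt_mem_arc_self 2⟩
    ((isOpen_lt continuous_re.abs continuous_const).and ((isOpen_lt continuous_const continuous_im).and
      (isOpen_lt continuous_im continuous_const))) fun z hz => ?_
  obtain ⟨h1, h2, h3⟩ := (Literature.Probability.Percolation.mem_perturbQuad_arc_two hx hy Ψ).1 hz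
  show |(Ψ.symm z).re| < 1 - κ / 2 ∧ 1 + κ / 2 < (Ψ.symm z).im ∧ (Ψ.symm z).im < 1 + 2 * κ
  rw [abs_lt, h1]; refine ⟨⟨?_, ?_⟩, ?_, ?_⟩ <;> linarith

/-- Near the image `Ψ(K)` of a compact non-empty model set contained in the vertical line `re = c` with
ordinates in `[-1, 1]` (a vertical side of the model square), the model abscissa is close to `c` and
the model ordinate stays inside `(-(1+κ/2), 1+κ/2)`. [folklore] -/
theorem eventually_near_vside {K : Set ℂ} (hK : IsCompact K) (hKne : K.Nonempty) {c : ℝ}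
    (hKc : ∀ w ∈ K, w.re = c ∧ w.im ∈ Icc (-1 : ℝ) 1) (hκ : 0 < κ) :
    ∀ᶠ r in 𝓝[>] (0 : ℝ), ∀ z, infDist z (Ψ '' K) ≤ r →
      |(Ψ.symm z).re - c| < κ / 2 ∧ |(Ψ.symm z).im| < 1 + κ / 2 := by
  refine eventually_symm_mem Ψ (U := {w | |w.re - c| < κ / 2 ∧ |w.im| < 1 + κ / 2})
    (hK.image Ψ.continuous) (hKne.image Ψ)
    ((isOpen_lt (continuous_re.sub continuous_const).abs continuous_const).and
      (isOpen_lt continuous_im.abs continuous_const)) ?_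
  rintro _ ⟨w, hw, rfl⟩
  obtain ⟨h1, h2, h3⟩ := hKc w hw
  show |(Ψ.symm (Ψ w)).re - c| < κ / 2 ∧ |(Ψ.symm (Ψ w)).im| < 1 + κ / 2
  rw [Ψ.symm_apply_apply, h1, sub_self, abs_zero, abs_lt]
  exact ⟨by positivity, by linarith, by linarith⟩

/-- Near the image `Ψ([-1, 1]²)` of the closed model square, the model point stays inside the open
square `(-(1+κ/2), 1+κ/2)²`. [folklore] -/
theorem eventually_near_square (hκ : 0 < κ) :
    ∀ᶠ r in 𝓝[>] (0 : ℝ), ∀ z, infDist z (Ψ '' (Icc (-1) 1 ×ℂ Icc (-1) 1)) ≤ r →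
      |(Ψ.symm z).re| < 1 + κ / 2 ∧ |(Ψ.symm z).im| < 1 + κ / 2 := by
  have hne : (Icc (-1 : ℝ) 1 ×ℂ Icc (-1 : ℝ) 1).Nonempty := ⟨0, by simp [mem_reProdIm]⟩
  refine eventually_symm_mem Ψ (U := {w | |w.re| < 1 + κ / 2 ∧ |w.im| < 1 + κ / 2})
    ((isCompact_Icc.reProdIm isCompact_Icc).image Ψ.continuous) (hne.image Ψ)
    ((isOpen_lt continuous_re.abs continuous_const).and (isOpen_lt continuous_im.abs continuous_const)) ?_
  rintro _ ⟨w, hw, rfl⟩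
  obtain ⟨⟨h1, h2⟩, h3, h4⟩ := mem_reProdIm.1 hw
  show |(Ψ.symm (Ψ w)).re| < 1 + κ / 2 ∧ |(Ψ.symm (Ψ w)).im| < 1 + κ / 2
  rw [Ψ.symm_apply_apply, abs_lt, abs_lt]
  exact ⟨⟨by linarith, by linarith⟩, by linarith, by linarith⟩

end Model

/-! ### The crossing clause in the model -/

/-- **Two paths crossing a rectangle in transverse directions meet.**  `f : [0,1] → ℂ` goes from
`im ≤ c` to `im ≥ d` with abscissae in `[a, b]`, `g` goes from `re ≤ a` to `re ≥ b` with ordinates in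
`[c, d]`; clip both to the rectangle `[a, b] × [c, d]` (`exists_Icc_passage`) and apply the two-path
crossing lemma `exists_mem_of_crossing`. [folklore] -/
theorem exists_eq_of_transverse {f g : ℝ → ℂ} (hf : Continuous f) (hg : Continuous g) {a b c d : ℝ}
    (hab : a < b) (hcd : c < d)
    (hf0 : (f 0).im ≤ c) (hf1 : d ≤ (f 1).im) (hfre : ∀ t ∈ Icc (0 : ℝ) 1, (f t).re ∈ Icc a b)
    (hg0 : (g 0).re ≤ a) (hg1 : b ≤ (g 1).re) (hgim : ∀ s ∈ Icc (0 : ℝ) 1, (g s).im ∈ Icc c d) :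
    ∃ t ∈ Icc (0 : ℝ) 1, ∃ s ∈ Icc (0 : ℝ) 1, f t = g s := by
  -- clip `f` between its last passage at height `c` and first passage at height `d`
  obtain ⟨t₀, t₁, h0t₀, ht₀₁, ht₁1, hft₀, hft₁, hfI⟩ :=
    exists_Icc_passage (f := fun t => (f t).im) zero_le_one (by fun_prop) hf0 hf1 hcd
  -- clip `g` between its last passage at abscissa `a` and first passage at abscissa `b`
  obtain ⟨s₀, s₁, h0s₀, hs₀₁, hs₁1, hgs₀, hgs₁, hgI⟩ :=
    exists_Icc_passage (f := fun s => (g s).re) zero_le_one (by fun_prop) hg0 hg1 hab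
  set β : ℝ → ℂ := fun u => f (t₀ + u * (t₁ - t₀)) with hβ
  set γ : ℝ → ℂ := fun u => g (s₀ + u * (s₁ - s₀)) with hγ
  have hmemt : ∀ u ∈ Icc (0 : ℝ) 1, t₀ + u * (t₁ - t₀) ∈ Icc t₀ t₁ := fun u hu =>
    ⟨by nlinarith [hu.1, hu.2], by nlinarith [hu.1, hu.2]⟩
  have hmems : ∀ u ∈ Icc (0 : ℝ) 1, s₀ + u * (s₁ - s₀) ∈ Icc s₀ s₁ := fun u hu =>
    ⟨by nlinarith [hu.1, hu.2], by nlinarith [hu.1, hu.2]⟩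
  have hβK : MapsTo β (Icc 0 1) (Icc a b ×ℂ Icc c d) := fun u hu => by
    have h := hmemt u hu
    exact mem_reProdIm.2 ⟨hfre _ ⟨h0t₀.trans h.1, h.2.trans ht₁1⟩, hfI _ h⟩
  have hγK : MapsTo γ (Icc 0 1) (Icc a b ×ℂ Icc c d) := fun u hu => by
    have h := hmems u hu
    exact mem_reProdIm.2 ⟨hgI _ h, hgim _ ⟨h0s₀.trans h.1, h.2.trans hs₁1⟩⟩
  have hβ0 : (β 0).im = c := by
    show (f (t₀ + 0 * (t₁ - t₀))).im = c
    rw [zero_mul, add_zero]; exact hft₀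
  have hβ1 : (β 1).im = d := by
    show (f (t₀ + 1 * (t₁ - t₀))).im = d
    rw [one_mul, add_sub_cancel]; exact hft₁
  have hγ0 : (γ 0).re = a := by
    show (g (s₀ + 0 * (s₁ - s₀))).re = a
    rw [zero_mul, add_zero]; exact hgs₀
  have hγ1 : (γ 1).re = b := by
    show (g (s₀ + 1 * (s₁ - s₀))).re = b
    rw [one_mul, add_sub_cancel]; exact hgs₁
  obtain ⟨u, hu, v, hv, huv⟩ := Literature.Topology.PlaneTopology.exists_mem_of_crossing
    (β := β) (γ := γ) (by fun_prop) (by fun_prop) hβK hγK hβ0 hβ1 hγ0 hγ1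
  refine ⟨t₀ + v * (t₁ - t₀), ?_, s₀ + u * (s₁ - s₀), ?_, huv⟩
  · have := hmemt v hv; exact ⟨h0t₀.trans this.1, this.2.trans ht₁1⟩
  · have := hmems u hu; exact ⟨h0s₀.trans this.1, this.2.trans hs₁1⟩

/-- **The crossing clause of `upperMargins` for a perturbed quad in a model `Ψ`.**  Let
`Q = Ψ([-1+κ, 1-κ] × [-1-κ, 1+κ])` (arc `0` = bottom cap edge, arc `2` = top cap edge), `A₀ = Ψ`(left
side of the model square), `A₂ = Ψ`(right side), and `C` a set with `closure C = Ψ([-1,1]²)`.  For all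
small `r > 0`: every path within `r` of `closure Q` from within `r` of `Q.arc 0` to within `r` of
`Q.arc 2` meets every path within `r` of `C` from within `r` of `A₀` to within `r` of `A₂` (in the
model the first crosses the rectangle `[-1+κ/2, 1-κ/2] × [-1-κ/2, 1+κ/2]` vertically, the second
horizontally). [folklore] -/
theorem eventually_crossing (Ψ : ℂ ≃ₜ ℂ) {κ : ℝ} (hκ : 0 < κ) (hκ1 : κ ≤ 1 / 2)
    (hx : -1 + κ < 1 - κ) (hy : -1 - κ < 1 + κ) {A₀ A₂ C : Set ℂ}
    (hA₀ : A₀ = Ψ '' unitSquareQuad.arc 3) (hA₂ : A₂ = Ψ '' unitSquareQuad.arc 1)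
    (hC : closure C = Ψ '' (Icc (-1) 1 ×ℂ Icc (-1) 1)) :
    ∀ᶠ r in 𝓝[>] (0 : ℝ), ∀ (p₁ p₃ q₀ q₂ : ℂ) (P : Path p₁ p₃) (Q : Path q₀ q₂),
      infDist p₁ ((perturbQuad Ψ (-1 + κ) (1 - κ) (-1 - κ) (1 + κ) hx hy).arc 0) ≤ r →
      infDist p₃ ((perturbQuad Ψ (-1 + κ) (1 - κ) (-1 - κ) (1 + κ) hx hy).arc 2) ≤ r →
      (∀ t, infDist (P t) (closure (perturbQuad Ψ (-1 + κ) (1 - κ) (-1 - κ) (1 + κ) hx hy).carrier) ≤ r) →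
      infDist q₀ A₀ ≤ r → infDist q₂ A₂ ≤ r → (∀ s, infDist (Q s) C ≤ r) →
      ∃ t s, P t = Q s := by
  have e4 : ∀ᶠ r in 𝓝[>] (0 : ℝ), ∀ z, infDist z A₀ ≤ r →
      |(Ψ.symm z).re - (-1)| < κ / 2 ∧ |(Ψ.symm z).im| < 1 + κ / 2 := by
    rw [hA₀]
    exact eventually_near_vside Ψ (unitSquareQuad.isCompact_arc 3) ⟨_, unitSquareQuad.pt_mem_arc_self 3⟩
      (fun w hw => Literature.Probability.Percolation.SquareModel.mem_arc_three.1 hw) hκ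
  have e5 : ∀ᶠ r in 𝓝[>] (0 : ℝ), ∀ z, infDist z A₂ ≤ r →
      |(Ψ.symm z).re - 1| < κ / 2 ∧ |(Ψ.symm z).im| < 1 + κ / 2 := by
    rw [hA₂]
    exact eventually_near_vside Ψ (unitSquareQuad.isCompact_arc 1) ⟨_, unitSquareQuad.pt_mem_arc_self 1⟩
      (fun w hw => Literature.Probability.Percolation.SquareModel.mem_arc_one.1 hw) hκ
  filter_upwards [eventually_arc_zero Ψ hx hy hκ, eventually_arc_two Ψ hx hy hκ,
    eventually_mem_box Ψ hx hy hκ, e4, e5, eventually_near_square Ψ hκ] with r h1 h2 h3 h4 h5 h6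
  intro p₁ p₃ q₀ q₂ P Q hp₁ hp₃ hP hq₀ hq₂ hQ
  set f : ℝ → ℂ := fun t => Ψ.symm (P.extend t) with hf
  set g : ℝ → ℂ := fun s => Ψ.symm (Q.extend s) with hg
  have hQ' : ∀ s, infDist (Q s) (Ψ '' (Icc (-1) 1 ×ℂ Icc (-1) 1)) ≤ r := fun s => by
    rw [← hC, infDist_closure]; exact hQ s
  have hf0 : (f 0).im ≤ -1 - κ / 2 := by
    show (Ψ.symm (P.extend 0)).im ≤ -1 - κ / 2
    rw [Path.extend_zero]; exact (h1 p₁ hp₁).2.2.le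
  have hf1 : 1 + κ / 2 ≤ (f 1).im := by
    show 1 + κ / 2 ≤ (Ψ.symm (P.extend 1)).im
    rw [Path.extend_one]; exact (h2 p₃ hp₃).2.1.le
  have hfre : ∀ t ∈ Icc (0 : ℝ) 1, (f t).re ∈ Icc (-1 + κ / 2) (1 - κ / 2) := fun t ht => by
    have h := (h3 (P.extend t) (by rw [Path.extend_apply _ ht]; exact hP _)).1
    rw [abs_lt] at h
    exact ⟨by linarith [h.1], by linarith [h.2]⟩
  have hg0 : (g 0).re ≤ -1 + κ / 2 := by
    show (Ψ.symm (Q.extend 0)).re ≤ -1 + κ / 2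
    rw [Path.extend_zero]
    have h := (h4 q₀ hq₀).1; rw [abs_lt] at h; linarith [h.2]
  have hg1 : 1 - κ / 2 ≤ (g 1).re := by
    show 1 - κ / 2 ≤ (Ψ.symm (Q.extend 1)).re
    rw [Path.extend_one]
    have h := (h5 q₂ hq₂).1; rw [abs_lt] at h; linarith [h.1]
  have hgim : ∀ s ∈ Icc (0 : ℝ) 1, (g s).im ∈ Icc (-1 - κ / 2) (1 + κ / 2) := fun s hs => by
    have h := (h6 (Q.extend s) (by rw [Path.extend_apply _ hs]; exact hQ' _)).2
    rw [abs_lt] at h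
    exact ⟨by linarith [h.1], by linarith [h.2]⟩
  obtain ⟨t, ht, s, hs, hts⟩ := exists_eq_of_transverse (f := f) (g := g)
    (Ψ.symm.continuous.comp P.continuous_extend) (Ψ.symm.continuous.comp Q.continuous_extend)
    (by linarith) (by linarith) hf0 hf1 hfre hg0 hg1 hgim
  refine ⟨⟨t, ht⟩, ⟨s, hs⟩, Ψ.symm.injective ?_⟩
  simpa only [hf, hg, Path.extend_apply _ ht, Path.extend_apply _ hs] using hts

/-! ### The cap and collar clauses of the lower perturbed quad -/

section Lower

variable {R : ConformalRectangle} {Φ : ℂ ≃ₜ ℂ}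

/-- In a square model, membership in the closed rectangle is read off the model coordinates. [folklore] -/
theorem mem_closure_iff_of_isSquareModel (hΦ : IsSquareModel R Φ) (z : ℂ) :
    z ∈ closure R.carrier ↔ (Φ.symm z).re ∈ Icc (-1 : ℝ) 1 ∧ (Φ.symm z).im ∈ Icc (-1 : ℝ) 1 := by
  rw [← hΦ.image_Icc, Φ.image_eq_preimage_symm, mem_preimage, mem_reProdIm]

/-- In a square model, membership in the arc `R.arc k` is membership of the model point in side `k`
of the model square. [folklore] -/
theorem mem_arc_iff_of_isSquareModel (hΦ : IsSquareModel R Φ) (k : Fin 4) (z : ℂ) :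
    z ∈ R.arc k ↔ Φ.symm z ∈ unitSquareQuad.arc k := by
  rw [← hΦ.image_arc k, Φ.image_eq_preimage_symm, mem_preimage]

/-- A closed model box pulled back by `Φ⁻¹` is compact. [folklore] -/
theorem isCompact_symm_preimage_box (Φ : ℂ ≃ₜ ℂ) (a b c d : ℝ) :
    IsCompact (Φ.symm ⁻¹' (Icc a b ×ℂ Icc c d)) :=
  Φ.symm.isCompact_preimage.2 (isCompact_Icc.reProdIm isCompact_Icc)

variable (hΦ : IsSquareModel R Φ) {κ : ℝ} (hκ : 0 < κ) (hκ1 : κ ≤ 1 / 2)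
  (hx : -1 + κ < 1 - κ) (hy : -1 - κ < 1 + κ)
include hΦ hκ hκ1

/-- **The clauses of `lowerMargins` for the lower perturbed quad `Φ([-1+κ, 1-κ] × [-1-κ, 1+κ])` of a
square model**, for all small `r > 0` ((L4)–(L9): caps `F₀ = Φ([-1+κ/2, 1-κ/2] × [-1-2κ, -1])`,
`F₂ = Φ([-1+κ/2, 1-κ/2] × [1, 1+2κ])` far from `R.arc 2`, `R.arc 0`; the `r`-neighbourhood of the closed
quad far from `R.arc 1`, `R.arc 3`, its part off `closure Ω` inside `F₀ ∪ F₂`; the `r`-neighbourhoods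
of the cap edges off `closure Ω`, inside `F₀`, resp. `F₂`). [folklore] -/
theorem eventually_lower : ∀ᶠ r in 𝓝[>] (0 : ℝ),
    (∀ z ∈ Φ.symm ⁻¹' (Icc (-1 + κ / 2) (1 - κ / 2) ×ℂ Icc (-1 - 2 * κ) (-1)), r ≤ infDist z (R.arc 2)) ∧
    (∀ z ∈ Φ.symm ⁻¹' (Icc (-1 + κ / 2) (1 - κ / 2) ×ℂ Icc 1 (1 + 2 * κ)), r ≤ infDist z (R.arc 0)) ∧
    (∀ z, infDist z (closure (perturbQuad Φ (-1 + κ) (1 - κ) (-1 - κ) (1 + κ) hx hy).carrier) ≤ r →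
      r ≤ infDist z (R.arc 1) ∧ r ≤ infDist z (R.arc 3)) ∧
    (∀ z, infDist z (closure (perturbQuad Φ (-1 + κ) (1 - κ) (-1 - κ) (1 + κ) hx hy).carrier) ≤ r →
      z ∉ closure R.carrier →
      z ∈ Φ.symm ⁻¹' (Icc (-1 + κ / 2) (1 - κ / 2) ×ℂ Icc (-1 - 2 * κ) (-1)) ∪
        Φ.symm ⁻¹' (Icc (-1 + κ / 2) (1 - κ / 2) ×ℂ Icc 1 (1 + 2 * κ))) ∧
    (∀ z, infDist z ((perturbQuad Φ (-1 + κ) (1 - κ) (-1 - κ) (1 + κ) hx hy).arc 0) ≤ r →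
      z ∉ closure R.carrier ∧ z ∈ Φ.symm ⁻¹' (Icc (-1 + κ / 2) (1 - κ / 2) ×ℂ Icc (-1 - 2 * κ) (-1))) ∧
    (∀ z, infDist z ((perturbQuad Φ (-1 + κ) (1 - κ) (-1 - κ) (1 + κ) hx hy).arc 2) ≤ r →
      z ∉ closure R.carrier ∧ z ∈ Φ.symm ⁻¹' (Icc (-1 + κ / 2) (1 - κ / 2) ×ℂ Icc 1 (1 + 2 * κ))) := by
  set Q := perturbQuad Φ (-1 + κ) (1 - κ) (-1 - κ) (1 + κ) hx hy with hQ
  have hclos := mem_closure_iff_of_isSquareModel hΦ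
  have harc := mem_arc_iff_of_isSquareModel hΦ
  have e1 : ∀ᶠ r in 𝓝[>] (0 : ℝ), ∀ z,
      infDist z (Φ.symm ⁻¹' (Icc (-1 + κ / 2) (1 - κ / 2) ×ℂ Icc (-1 - 2 * κ) (-1))) ≤ r →
        r ≤ infDist z (R.arc 2) := by
    refine eventually_le_infDist (isCompact_symm_preimage_box Φ _ _ _ _)
      ⟨Φ ⟨0, -1 - κ⟩, ?_⟩ (R.isClosed_arc 2) ⟨_, R.pt_mem_arc_self 2⟩ (disjoint_left.2 fun z hz hz' => ?_)
    · rw [mem_preimage, Φ.symm_apply_apply, mem_reProdIm, mem_Icc, mem_Icc]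
      exact ⟨⟨by norm_num; linarith, by norm_num; linarith⟩, by norm_num; linarith, by norm_num; linarith⟩
    · have h1 := (mem_reProdIm.1 hz).2.2
      have h2 := (Literature.Probability.Percolation.SquareModel.mem_arc_two.1 ((harc 2 z).1 hz')).1
      linarith
  have e2 : ∀ᶠ r in 𝓝[>] (0 : ℝ), ∀ z,
      infDist z (Φ.symm ⁻¹' (Icc (-1 + κ / 2) (1 - κ / 2) ×ℂ Icc 1 (1 + 2 * κ))) ≤ r →
        r ≤ infDist z (R.arc 0) := by
    refine eventually_le_infDist (isCompact_symm_preimage_box Φ _ _ _ _)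
      ⟨Φ ⟨0, 1 + κ⟩, ?_⟩ (R.isClosed_arc 0) ⟨_, R.pt_mem_arc_self 0⟩ (disjoint_left.2 fun z hz hz' => ?_)
    · rw [mem_preimage, Φ.symm_apply_apply, mem_reProdIm, mem_Icc, mem_Icc]
      exact ⟨⟨by norm_num; linarith, by norm_num; linarith⟩, by norm_num; linarith, by norm_num; linarith⟩
    · have h1 := (mem_reProdIm.1 hz).2.1
      have h2 := (Literature.Probability.Percolation.SquareModel.mem_arc_zero.1 ((harc 0 z).1 hz')).1
      linarith
  have e3 : ∀ᶠ r in 𝓝[>] (0 : ℝ), ∀ z, infDist z (closure Q.carrier) ≤ r → r ≤ infDist z (R.arc 1) := by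
    refine eventually_le_infDist (isCompact_closure_perturbQuad Φ hx hy) (closure_perturbQuad_nonempty Φ hx hy)
      (R.isClosed_arc 1) ⟨_, R.pt_mem_arc_self 1⟩ (disjoint_left.2 fun z hz hz' => ?_)
    have h1 := ((Literature.Probability.Percolation.mem_closure_perturbQuad_carrier hx hy Φ).1 hz).1.2
    have h2 := (Literature.Probability.Percolation.SquareModel.mem_arc_one.1 ((harc 1 z).1 hz')).1
    linarith
  have e4 : ∀ᶠ r in 𝓝[>] (0 : ℝ), ∀ z, infDist z (closure Q.carrier) ≤ r → r ≤ infDist z (R.arc 3) := by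
    refine eventually_le_infDist (isCompact_closure_perturbQuad Φ hx hy) (closure_perturbQuad_nonempty Φ hx hy)
      (R.isClosed_arc 3) ⟨_, R.pt_mem_arc_self 3⟩ (disjoint_left.2 fun z hz hz' => ?_)
    have h1 := ((Literature.Probability.Percolation.mem_closure_perturbQuad_carrier hx hy Φ).1 hz).1.1
    have h2 := (Literature.Probability.Percolation.SquareModel.mem_arc_three.1 ((harc 3 z).1 hz')).1
    linarith
  filter_upwards [eventually_mem_nhdsWithin, e1, e2, e3, e4, eventually_mem_box Φ hx hy hκ,
    eventually_arc_zero Φ hx hy hκ, eventually_arc_two Φ hx hy hκ] with r hr h1 h2 h3 h4 h5 h6 h7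
  refine ⟨fun z hz => h1 z (infDist_zero_of_mem hz ▸ le_of_lt hr),
    fun z hz => h2 z (infDist_zero_of_mem hz ▸ le_of_lt hr), fun z hz => ⟨h3 z hz, h4 z hz⟩,
    fun z hz hzc => ?_, fun z hz => ?_, fun z hz => ?_⟩
  · obtain ⟨hre, him⟩ := h5 z hz
    rw [abs_lt] at hre him
    rw [hclos] at hzc
    simp only [mem_union, mem_preimage, mem_reProdIm, mem_Icc]
    by_cases hlow : (Φ.symm z).im < -1
    · exact Or.inl ⟨⟨by linarith, by linarith⟩, by linarith, hlow.le⟩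
    · right
      refine ⟨⟨by linarith, by linarith⟩, ?_, by linarith⟩
      by_contra hhi
      exact hzc ⟨⟨by linarith, by linarith⟩, not_lt.1 hlow, (not_le.1 hhi).le⟩
  · obtain ⟨hre, him1, him2⟩ := h6 z hz
    rw [abs_lt] at hre
    refine ⟨fun hzc => ?_, ?_⟩
    · rw [hclos] at hzc; linarith [hzc.2.1]
    · rw [mem_preimage, mem_reProdIm]
      exact ⟨⟨by linarith, by linarith⟩, by linarith, by linarith⟩
  · obtain ⟨hre, him1, him2⟩ := h7 z hz
    rw [abs_lt] at hre
    refine ⟨fun hzc => ?_, ?_⟩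
    · rw [hclos] at hzc; linarith [hzc.2.2]
    · rw [mem_preimage, mem_reProdIm]
      exact ⟨⟨by linarith, by linarith⟩, by linarith, by linarith⟩

end Lower

end Perturbed

/-- **Registered sub-goal `stub_perturbedRectangles_part1`** of `stub_perturbedRectangles` (S1): the
crossing clause of `upperMargins` for a perturbed quad read in a model homeomorphism (the statement of
`Perturbed.eventually_crossing`, filter spelled out). [folklore] -/
theorem stub_perturbedRectangles_part1 : ∀ (Ψ : ℂ ≃ₜ ℂ) {κ : ℝ}, 0 < κ → κ ≤ 1 / 2 → ∀ (hx : -1 + κ < 1 - κ) (hy : -1 - κ < 1 + κ) {A₀ A₂ C : Set ℂ}, A₀ = Ψ '' unitSquareQuad.arc 3 → A₂ = Ψ '' unitSquareQuad.arc 1 → closure C = Ψ '' (Set.Icc (-1) 1 ×ℂ Set.Icc (-1) 1) → Filter.Eventually (fun r : ℝ => ∀ (p₁ p₃ q₀ q₂ : ℂ) (P : Path p₁ p₃) (Q : Path q₀ q₂), Metric.infDist p₁ ((perturbQuad Ψ (-1 + κ) (1 - κ) (-1 - κ) (1 + κ) hx hy).arc 0) ≤ r → Metric.infDist p₃ ((perturbQuad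 Ψ (-1 + κ) (1 - κ) (-1 - κ) (1 + κ) hx hy).arc 2) ≤ r → (∀ t, Metric.infDist (P t) (closure (perturbQuad Ψ (-1 + κ) (1 - κ) (-1 - κ) (1 + κ) hx hy).carrier) ≤ r) → Metric.infDist q₀ A₀ ≤ r → Metric.infDist q₂ A₂ ≤ r → (∀ s, Metric.infDist (Q s) C ≤ r) → ∃ t s, P t = Q s) (nhdsWithin (0 : ℝ) (Set.Ioi 0)) :=
  fun Ψ _ hκ hκ1 hx hy _ _ _ hA₀ hA₂ hC => Perturbed.eventually_crossing Ψ hκ hκ1 hx hy hA₀ hA₂ hC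

end Summit.CriticalPhenomena.CardyFormulaZ2.Cruxes.SquareFromVoronoiHub.VoronoiBlocks.Faithful

end
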